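import Literature.AlgebraicGeometry.Deligne1982.WeilTypeCMGeneralMemberHodgeConjectureCriteria
import HarnessLib

/-!
# The general CM-Weil abelian variety: Hodge classes below the Weil degree are algebraic

Deligne [Deligne1982HodgeCycles, §4 and Milne's 2003 re-edition endnote 16]: for a general polarized abelian variety
`(A, η, h)` of Weil type relative to a CM field `E` (`Hg(A) = SU(φ)`, tree `HasHodgeGroupSUCM`), «the `ℚ`-algebra of Hodge
classes is generated by the divisor classes and the Weil classes `W_E ⊆ H^{2k}`» (tree
`IsWeilTypeCM.hodgeClassSpan_le_divisorWeilAlgebra_of_hodgeGroupSU`, `k = dim_E H¹(A, ℚ)/2`). Since the Weil classes live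
in degree `2k`, IN CODIMENSION `p < k` EVERY HODGE CLASS IS A POLYNOMIAL IN DIVISOR CLASSES, hence algebraic (Lefschetz
`(1,1)` and the standing multiplicativity hypothesis `hcup` on the algebraic classes): the Hodge conjecture holds for the
general member, its `E`-isogeny class and its isogeny class in every codimension `p < k`, unconditionally in the Weil
classes (the companion of van Geemen's «`Bᵖ = Dᵖ` for `p ≠ n`», Thm. 6.12, for CM fields, below the Weil degree).

## What (all `theorem`s, no new definitions, no new facts)

* §1 (the generated algebra, any `(A, φ, P, k)`): **`divisorWeilAlgebra_le_of_lt`** — for `p < k` the divisor–Weil algebra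
  `DWᵖ` lies in EVERY even cup subalgebra containing the rational `(1,1)`-classes (no condition on `W_E`: truncate the family
  above degree `k`); **`divisorWeilAlgebra_le_algebraicClasses_of_lt`** (`DWᵖ ⊆ Nᵖ ⊗ ℂ` for `p < k`, under `hcup`).
* §2 (the general member, `Hg(A) = SU(φ)`): **`IsWeilTypeCM.hodgeClassSpan_le_algebraicClasses_of_lt_of_hodgeGroupSU`**,
  **`IsWeilTypeCM.mem_algebraicClasses_of_lt_of_hodgeGroupSU`** (HC in codimension `p < k`),
  `mem_algebraicClasses_of_lt_of_isIsogeny_of_hasHodgeGroupSUCM` (the `E`-isogeny class),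
  **`mem_algebraicClasses_of_lt_of_isIsogenous_of_hasHodgeGroupSUCM`** (the plain isogeny class, van Geemen 3.7 per
  codimension, tree `mem_algebraicClasses_of_isIsogeny`).

## References

* [Deligne1982HodgeCycles] P. Deligne, *Hodge cycles on abelian varieties*, LNM 900 (1982), §4 (4.4)–(4.5); Milne's 2003
  re-edition, endnote 16.
* [vanGeemen1994HodgeAV] B. van Geemen, in: *Algebraic Cycles and Hodge Theory*, LNM 1594 (1994), 3.6–3.7 (p. 236), Thm. 6.12.
* [Milne2025AbelianMotivesCharP] J. S. Milne, *Abelian motives in characteristic p*, arXiv:2508.09972, §1.5 Example 1.17.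
* [VoisinHodgeI2002] C. Voisin, *Hodge Theory and Complex Algebraic Geometry I*, Thm. 11.30 (Lefschetz `(1,1)`).
-/

noncomputable section

open CategoryTheory Polynomial
open Literature.AlgebraicTopology.SingularHomology
open Literature.AlgebraicGeometry.Motives
open Literature.AlgebraicGeometry.HodgeTheory
open Literature.AlgebraicGeometry.VanGeemen1994
open Literature.AlgebraicGeometry.Milne1999

namespace Literature.AlgebraicGeometry.Deligne1982

/-! ### §1 Below degree `k` the divisor–Weil algebra does not see the Weil classes -/

section Truncation

variable {A : AbelianVariety ℂ} {φ : A ⟶ A} {P : Polynomial ℤ} {k : ℕ}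

/-- **`DWᵖ ⊆ Gᵖ` for `p < k`** and every even cup subalgebra `G` of `H^{2•}(A(ℂ); ℂ)` containing the rational `(1,1)`-classes:
the truncated family `(q ↦ Gᵠ for q < k, H^{2q} for q ≥ k)` is a divisor–Weil family (the Weil classes `W_E ⊆ H^{2k}` impose
no condition below degree `k`). [cite: Deligne1982HodgeCycles, Milne 2003 re-edition endnote 16] -/
theorem divisorWeilAlgebra_le_of_lt {G : (p : ℕ) → Submodule ℂ (complexBetti A.X (2 * p))} (hG : IsEvenCupSubalgebra A.X G)
    (h11 : ∀ ⦃b : complexBetti A.X (2 * 1)⦄, IsRationalClass b → IsOfHodgeType A.dim A.X (2 * 1) 1 1 b → b ∈ G 1)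
    {p : ℕ} (hp : p < k) : divisorWeilAlgebra A φ P k p ≤ G p := by
  classical
  let G' : (q : ℕ) → Submodule ℂ (complexBetti A.X (2 * q)) := fun q ↦ if q < k then G q else ⊤
  have hG' : IsDivisorWeilFamily A φ P k G' :=
    { one_mem := by
        change _ ∈ (if 0 < k then G 0 else ⊤)
        rw [if_pos (by omega)]
        exact hG.one_mem
      cup_mem := fun q r a b ha hb ↦ by
        change a ∈ (if q < k then G q else ⊤) at ha
        change b ∈ (if r < k then G r else ⊤) at hb
        change _ ∈ (if q + r < k then G (q + r) else ⊤)
        by_cases hqr : q + r < k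
        · rw [if_pos (show q < k by omega)] at ha
          rw [if_pos (show r < k by omega)] at hb
          rw [if_pos hqr]
          exact hG.cup_mem ha hb
        · rw [if_neg hqr]
          exact Submodule.mem_top
      oneOne_mem := fun b hb hb' ↦ by
        change b ∈ (if 1 < k then G 1 else ⊤)
        by_cases h1 : 1 < k
        · rw [if_pos h1]
          exact h11 hb hb'
        · rw [if_neg h1]
          exact Submodule.mem_top
      weilClassesField_le := by
        change weilClassesField A φ P (2 * k) ≤ (if k < k then G k else ⊤)
        rw [if_neg (lt_irrefl k)]
        exact le_top }
  have hle := divisorWeilAlgebra_le hG' p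
  change divisorWeilAlgebra A φ P k p ≤ (if p < k then G p else ⊤) at hle
  rwa [if_pos hp] at hle

/-- **`DWᵖ ⊆ Nᵖ ⊗ ℂ` for `p < k`** (the algebraic classes are an even cup subalgebra — hypothesis `hcup` — containing the
rational `(1,1)`-classes by Lefschetz `(1,1)`, tree `lefschetzOneOne_rational_holds`); no hypothesis on the Weil classes.
[cite: Deligne1982HodgeCycles, Milne 2003 re-edition endnote 16] [cite: VoisinHodgeI2002, Thm. 11.30] -/
theorem divisorWeilAlgebra_le_algebraicClasses_of_lt (hcup : IsEvenCupSubalgebra A.X (fun p => algebraicClasses A.X p))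
    {p : ℕ} (hp : p < k) : divisorWeilAlgebra A φ P k p ≤ algebraicClasses A.X p :=
  divisorWeilAlgebra_le_of_lt (G := fun p => algebraicClasses A.X p) hcup
    (fun _ hb hb' ↦ lefschetzOneOne_rational_holds (Motives.AbelianVariety.isSmoothProjective_holds (A := A)) _ hb hb') hp

end Truncation

/-! ### §2 The Hodge conjecture below the Weil degree for the general member and its isogeny class -/

section GeneralMember

variable {A : AbelianVariety ℂ} {η : A ⟶ A} {R : Polynomial ℤ} {e₀ k : ℕ} {h : complexBetti A.X 2}

/-- **`Bᵖ ⊗ ℂ ⊆ Nᵖ ⊗ ℂ` for `p < k`** for a general CM-Weil `(A, η, h)` (`Hg(A) = SU(φ)`): `Bᵖ ⊆ DWᵖ` (endnote 16, tree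
`IsWeilTypeCM.hodgeClassSpan_le_divisorWeilAlgebra_of_hodgeGroupSU`) and `DWᵖ ⊆ Nᵖ` below degree `k` (§1).
[cite: Deligne1982HodgeCycles, §4 and Milne 2003 re-edition endnote 16] [cite: vanGeemen1994HodgeAV, Thm. 6.12 («Bᵖ = Dᵖ, p ≠ n»)] -/
theorem IsWeilTypeCM.hodgeClassSpan_le_algebraicClasses_of_lt_of_hodgeGroupSU (hW : IsWeilTypeCM A η R e₀ k)
    (hpol : IsPolarizationClass A.dim A.X h) (hRos : IsRosatiCM A η h) (hSU : HasHodgeGroupSUCM A η (R.comp (X ^ 2)) h)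
    (hcup : IsEvenCupSubalgebra A.X (fun p => algebraicClasses A.X p)) {p : ℕ} (hp : p < k) :
    hodgeClassSpan A.dim A.X p ≤ algebraicClasses A.X p :=
  (hW.hodgeClassSpan_le_divisorWeilAlgebra_of_hodgeGroupSU hpol hRos hSU p).trans
    (divisorWeilAlgebra_le_algebraicClasses_of_lt hcup hp)

/-- **THE HODGE CONJECTURE IN CODIMENSION `p < k` FOR THE GENERAL CM-WEIL ABELIAN VARIETY**: every rational class of
type `(p,p)` with `p < k` is algebraic (under `hcup`; nothing is assumed about the Weil classes).
[cite: Deligne1982HodgeCycles, §4 and Milne 2003 re-edition endnote 16] [cite: Milne2025AbelianMotivesCharP, §1.5 Example 1.17]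
[cite: vanGeemen1994HodgeAV, Thm. 6.12] -/
theorem IsWeilTypeCM.mem_algebraicClasses_of_lt_of_hodgeGroupSU (hW : IsWeilTypeCM A η R e₀ k)
    (hpol : IsPolarizationClass A.dim A.X h) (hRos : IsRosatiCM A η h) (hSU : HasHodgeGroupSUCM A η (R.comp (X ^ 2)) h)
    (hcup : IsEvenCupSubalgebra A.X (fun p => algebraicClasses A.X p)) {p : ℕ} (hp : p < k)
    {c : complexBetti A.X (2 * p)} (hc : IsRationalClass c) (hpp : IsOfHodgeType A.dim A.X (2 * p) p p c) :
    c ∈ algebraicClasses A.X p :=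
  hW.hodgeClassSpan_le_algebraicClasses_of_lt_of_hodgeGroupSU hpol hRos hSU hcup hp (Submodule.subset_span ⟨hc, hpp⟩)

variable {B : AbelianVariety ℂ} {f : A ⟶ B} {θ : B ⟶ B} {h' : complexBetti B.X 2}

/-- **… on the `E`-isogeny class**: along an `E`-equivariant isogeny `f : A ⟶ B` to a general CM-Weil `(B, θ, h')`, every
rational `(p,p)`-class of `A` with `p < k` is algebraic (`hcup` on `B`, transported by
`isEvenCupSubalgebra_algebraicClasses_of_isIsogeny`). [cite: Deligne1982HodgeCycles, Milne 2003 re-edition endnote 16]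
[cite: vanGeemen1994HodgeAV, 3.6–3.7 (p. 236) and Thm. 6.12] -/
theorem mem_algebraicClasses_of_lt_of_isIsogeny_of_hasHodgeGroupSUCM (hW : IsWeilTypeCM B θ R e₀ k)
    (hpol : IsPolarizationClass B.dim B.X h') (hRos : IsRosatiCM B θ h') (hSU : HasHodgeGroupSUCM B θ (R.comp (X ^ 2)) h')
    (hcup : IsEvenCupSubalgebra B.X (fun p => algebraicClasses B.X p)) (hf : AbelianVariety.IsIsogeny f)
    (hcomm : f ≫ θ = η ≫ f) {p : ℕ} (hp : p < k) {c : complexBetti A.X (2 * p)} (hc : IsRationalClass c)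
    (hpp : IsOfHodgeType A.dim A.X (2 * p) p p c) : c ∈ algebraicClasses A.X p :=
  divisorWeilAlgebra_le_algebraicClasses_of_lt (isEvenCupSubalgebra_algebraicClasses_of_isIsogeny hf hcup) hp
    (hW.mem_divisorWeilAlgebra_of_isIsogeny_of_hodgeGroupSU hpol hRos hSU hf hcomm hc hpp)

/-- **… on the plain isogeny class**: for every `C` isogenous to a general CM-Weil `(A, η, h)`, every rational `(p,p)`-class
of `C` with `p < k` is algebraic (van Geemen's Lemma 3.7 per codimension, tree `mem_algebraicClasses_of_isIsogeny`).
[cite: vanGeemen1994HodgeAV, 3.6–3.7 Lemma 3.7 (p. 236) and Thm. 6.12] [cite: Deligne1982HodgeCycles, Milne 2003 re-edition endnote 16] -/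
theorem mem_algebraicClasses_of_lt_of_isIsogenous_of_hasHodgeGroupSUCM {C : AbelianVariety ℂ} (hW : IsWeilTypeCM A η R e₀ k)
    (hpol : IsPolarizationClass A.dim A.X h) (hRos : IsRosatiCM A η h) (hSU : HasHodgeGroupSUCM A η (R.comp (X ^ 2)) h)
    (hcup : IsEvenCupSubalgebra A.X (fun p => algebraicClasses A.X p)) (hC : AbelianVariety.IsIsogenous C A)
    {p : ℕ} (hp : p < k) {c : complexBetti C.X (2 * p)} (hc : IsRationalClass c)
    (hpp : IsOfHodgeType C.dim C.X (2 * p) p p c) : c ∈ algebraicClasses C.X p := by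
  obtain ⟨g, hg⟩ := hC.symm'
  exact mem_algebraicClasses_of_isIsogeny g hg
    (nonempty_hodgeModel_holds (Motives.AbelianVariety.isSmoothProjective_holds (A := A))).some
    (fun _ hc' hpp' ↦ hW.mem_algebraicClasses_of_lt_of_hodgeGroupSU hpol hRos hSU hcup hp hc' hpp') hc hpp

end GeneralMember

end Literature.AlgebraicGeometry.Deligne1982

end
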